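import Summits.Ventures.HodgeKum4.Theses.KummerFixedLocus
import Summits.Ventures.HodgeKum4.Theorems.KummerFixedLocusFrameComplementOfTranslationGroup
import HarnessLib

/-!
# Route KummerFixedLocus (`hodge-kum4`, rung H3) — the L1 support child `FrameComplementKum4` CLOSES (kernel)

Seat p1.  Item stmt-Ventures-19458 (route file rev 6, commit 4bc11cfb6771): the route decl
`Summit.Ventures.HodgeKum4.Theses.KummerFixedLocus.FrameComplementKum4 :=
Kum4TranslationGroup → Kum4TranslationGroupTrivialOffMiddle → FrameComplementKum4` — the frame-complement
clause of L1 with the route's OWN print-input items F_Γ (`|Γ(X)| = 625 ∧ dim 𝒦 ≤ 624`) and F_Γ′ (`Γ(X)`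
trivial on `Hᵏ`, `k ≠ 8`) as leading binders — is PROVED OUTRIGHT by the kernel theorem
`frameComplementKum4_of_translationGroup` (Theorems/KummerFixedLocusFrameComplementOfTranslationGroup,
p425525): `N' = 𝒦_tot`, Maschke in degree `8`, `H² ∪ 𝒦 = 0` from degree-`10` triviality.  UNCONDITIONAL
(no named-fact hypothesis; axioms standard).  HONEST FRAMING: a support item of the L1 split closes; nothing
here says `LefschetzGenerationKum4`, `HC_Kum4Type` or HC is proved.
-/

noncomputable section

namespace Summit.Ventures.HodgeKum4

/-- **Item stmt-Ventures-19458 (kernel, unconditional)**: the route decl `FrameComplementKum4` of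
`Theses.KummerFixedLocus` — `Kum4TranslationGroup → Kum4TranslationGroupTrivialOffMiddle →
FrameComplementKum4` — holds, by `frameComplementKum4_of_translationGroup`. -/
theorem frameComplementKum4_holds :
    Summit.Ventures.HodgeKum4.Theses.KummerFixedLocus.FrameComplementKum4 := by
  unfold Summit.Ventures.HodgeKum4.Theses.KummerFixedLocus.FrameComplementKum4
  exact fun hΓ hoff ↦ frameComplementKum4_of_translationGroup hΓ hoff

end Summit.Ventures.HodgeKum4

end
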